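import Summits.Schanuel.Schanuel.Theorems.RootDecomp1KOddEmpty01

/-!
# RootDecomp1KOddEmpty — lens 1, generation 60, NODE 21 «ODD-PRIME EMPTINESS ON THE K-LINE» (reduction of the whole curve modulo an odd prime ℓ: no affine 𝔽_ℓ-point and no liftable point over Y = ∞ ⇒ no rational point with ℓ-integral abscissa ⇒ every level empty; RULE K-R51 (iii) payable clause; CLAIM L2795, PRICE L2798, K-R52) — continuation (RootDecomp1KOddEmpty02): §4 THE W4-SHAPE ENGINE TangentEmptyAt (v_ℓ-descent at the double point (0, ∞)) and §4b the refusals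

(lens-1 g60 NODE 21 HOME kernel K = HOME/decomp-schanuel-lens-1/g60/OddEmpty.lean 5b3adebb…, 1208 l, imports tree …RootDecomp1KCubicDescent05 ONLY = the port of node 20 (no Literature import, no fact def, no private, no set_option, no structure; `decide` only on finite ZMod ℓ checks); Probe / Ctrl0 / Ctrl + NODE-g60.md + SHA256SUMS; CLAIM L2795, census LIVENESS-v16 L2796 (key oddempty; of record L2798), crit g10 EX-ANTE PRICE L2798 (ONE THEOREM ×1 for (A) the general engine OddEmptyAt + (B) the W4-shape engine TangentEmptyAt + (C) the infinite K-R51-territory family V j JOINTLY iff CHECKLIST K-g60 (1)–(11); RULE K-R52 pre-announced), writer g31 NOTE 1 L2799 (pre-kernel arithmetic re-verified), NODE L2801 / REQUEST L2802, critic VERDICT L2804 (crit g10): CLEARED — THEOREM ×1 for (A) the general engine OddEmptyAt + (B) the W4-shape engine TangentEmptyAt + (C) the infinite K-R51-territory family V j JOINTLY under RULE K-R51 (iii), CHECKLIST K-g60 (1)–(11) met 11/11, rung 0; LABEL OF RECORD: literature = KNOWN TOOL (local insolubility at a finite place / reduction mod ℓ restricted to S-integral points, Hensel failure at a double point with anisotropic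 tangent cone) · relative to the record = NEW LEVER (first odd-place reading of the curve on the K-line) with NEW REACH (first K-R51-territory pairs — no ℚ-rational descent datum — decided hypothesis-free, at the currency LevelFinite / every level EMPTY); RULE K-R52 FIXED verbatim as pre-announced L2798 (toolkit ∪= LOCAL SIEVING IN GENERAL — every further OddEmptyAt / TangentEmptyAt member, ℓ, cone, jet, residue-class or Brauer–Manin-type variant ×0-as-record; OPEN TERRITORY at m₀ = 2 := K-R51 territory ∧ LOCALLY LIVE (census key locsol); standing witness W4 with its smooth ℤ[1/2]-point (0, −2)); TALLY lens-1 ×18 + THEOREM ×20; PORT GO exactly as census STAGING NOTES 11/11b L2800/L2803. Port by census-1 gen 23 as `RootDecomp1KOddEmpty01–05` (`--supports stmt-Schanuel-33364`; no census credit): 01 = §0 helpers, §1 the tree's binary forms `hf` at a prime dividing den r, §2 the equation of a rational point in integers for every `xPolyP k c` and the level abscissa (`not_dvd_den_level`), §3 THE GENERAL ENGINE `OddEmptyAt ℓ P` ⇒ `ratPoint_free_of_oddEmptyAt` / `no_level_of_oddEmptyAt` / `levelFinite_of_oddEmptyAt` / `bddLevelEmpty_of_oddEmptyAt` / `thinFibreAt_of_oddEmptyAt`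 (every m₀); 02 = §4 THE W4-SHAPE ENGINE (`descent_step`, `tangent_descent` — the v_ℓ-descent at the double point (0, ∞) with anisotropic tangent form —, `TangentEmptyAt ℓ P` ⇒ `no_level_of_tangentEmptyAt` / `levelFinite_…` / `bddLevelEmpty_…` / `thinFibreAt_of_tangentEmptyAt`) and §4b the REFUSALS (a rational ℓ-integral point / a root at x = 0 / degree conditions / ℓ = 2 kill the hypotheses); 03 = §5 section Families: `VW l` / `V j := VW (−3 + 15j)` with `tangentEmptyAt_five_V`, **`no_level_V`**, **`levelFinite_V`**, `bddLevelEmpty_V`, **`thinFibreAt_V (j m₀)`** HYPOTHESIS-FREE for every m₀, `EAW l` / `EA j` with `oddEmptyAt_three_EA`, `no_level_EA`, `levelFinite_EA`, `thinFibreAt_EA`, the REFUSED members `W4P` (rational point (0, −2)), `VW (−9)`, `R5P`, CJ 0 — typed non-instances; 04 = §6 section Disc: `xDisc (VW l) = vD l` primitive and ℚ-IRREDUCIBLE for l = 3s by a RABIN certificate mod 3 using the TREE's `dvd_X_pow_sub_X_zmod3` / `irreducible_of_coprime_zmod3` / `irreducible_of_irreducible_map3` (node 20); 05 = §7 section Territory: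 `V_territory (j)` (the K-R49 conjunction by tree names ∧ the K-R51 k = 2 certificate `Irreducible ((xDisc (V j)).map ℚ)`, degree 6 ≡ 2 mod 4 ∧ LevelFinite ∧ ∀ m₀ ThinFibreAt), `V_injective`, named members V0 / V1. PORT EDITS: NONE beyond the provenance doc blocks and the continuation headers (no docstring added — K documents every declaration —, no privatisation — the head dry-run showed no dedup code —, no re-pointing, no import change, no set_option; K's `@[simp]` kept); provenance doc blocks + continuation headers = K's own open-lines; statements and proofs VERBATIM. Rung 0 — nothing here proves Schanuel, 33364, 33363, 31077 or ThinFibre 2; everything HYPOTHESIS-FREE.)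
-/

noncomputable section

namespace Summit.Schanuel.Schanuel.Theorems.RootDecomp1KOddEmpty

open Polynomial LiouvilleNumber
open scoped Nat
open Summit.Schanuel.Schanuel.Theorems.RootDecomp1KTwoBaseCell (psNumer partialSum_eq_psNumer_div coprime_psNumer)
open Summit.Schanuel.Schanuel.Theorems.RootDecomp1KDegreeLadder
open Summit.Schanuel.Schanuel.Theorems.RootDecomp1KXLinear
open Summit.Schanuel.Schanuel.Theorems.RootDecomp1KXLinearII
open Summit.Schanuel.Schanuel.Theorems.RootDecomp1KXTop
open Summit.Schanuel.Schanuel.Theorems.RootDecomp1KXAll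
open Summit.Schanuel.Schanuel.Theorems.RootDecomp1KLevelFinite
open Summit.Schanuel.Schanuel.Theorems.RootDecomp1KThueMahler
open Summit.Schanuel.Schanuel.Theorems.RootDecomp1KParamThueMahler
open Summit.Schanuel.Schanuel.Theorems.RootDecomp1KLocalExponent
open Summit.Schanuel.Schanuel.Theorems.RootDecomp1KIntegrality (GaussAt gaussAt_xPolyP_iff level_identity_rat)
open Summit.Schanuel.Schanuel.Theorems.RootDecomp1KSubspaceBranch (SepTopAt)
open Summit.Schanuel.Schanuel.Theorems.RootDecomp1KHeightGrading (BddLevelEmpty bddLevelEmpty_iff_levelFinite)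
open Summit.Schanuel.Schanuel.Theorems.RootDecomp1KRunge
open Summit.Schanuel.Schanuel.Theorems.RootDecomp1KDescent
open Summit.Schanuel.Schanuel.Theorems.RootDecomp1KCubicDescent

/-! ### §4 THE W4-SHAPE ENGINE (`k = 2`): the double point `(0, ∞)` with ANISOTROPIC tangent form — a `v_ℓ`-descent -/

/-- THE DESCENT STEP in `𝔽_ℓ`: `u ≠ 0`, `q ≠ 0`, the form `a₂X² + a₁XT + a₀T²` ANISOTROPIC; from
`p₁²·H₂ + p₁·q·d₁·H₁ + q²·d₁²·H₀ = 0` with `H₂ ≡ a₂uⁿ⁺², H₁ ≡ a₁uⁿ⁺¹, H₀ ≡ a₀uⁿ (mod ℓ)`: `ℓ ∣ p₁` and `ℓ ∣ d₁`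
(the reduction is `uⁿ · (a₂(u p₁)² + a₁(u p₁)(q d₁) + a₀(q d₁)²)`). -/
theorem descent_step {ℓ : ℕ} [Fact ℓ.Prime] (a₂ a₁ a₀ : ℤ)
    (haniso : ∀ a b : ZMod ℓ, (a₂ : ZMod ℓ) * a ^ 2 + (a₁ : ZMod ℓ) * a * b + (a₀ : ZMod ℓ) * b ^ 2 = 0 → a = 0 ∧ b = 0)
    {u q H₂ H₁ H₀ : ℤ} {n : ℕ} (hu : ((u : ℤ) : ZMod ℓ) ≠ 0) (hq : ((q : ℤ) : ZMod ℓ) ≠ 0)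
    (hH₂ : ((H₂ : ℤ) : ZMod ℓ) = (a₂ : ZMod ℓ) * (u : ZMod ℓ) ^ (n + 2))
    (hH₁ : ((H₁ : ℤ) : ZMod ℓ) = (a₁ : ZMod ℓ) * (u : ZMod ℓ) ^ (n + 1))
    (hH₀ : ((H₀ : ℤ) : ZMod ℓ) = (a₀ : ZMod ℓ) * (u : ZMod ℓ) ^ n)
    {p₁ d₁ : ℤ} (hE : p₁ ^ 2 * H₂ + p₁ * q * d₁ * H₁ + q ^ 2 * d₁ ^ 2 * H₀ = 0) :
    (ℓ : ℤ) ∣ p₁ ∧ (ℓ : ℤ) ∣ d₁ := by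
  have h := congrArg (Int.cast : ℤ → ZMod ℓ) hE
  simp only [Int.cast_add, Int.cast_mul, Int.cast_pow, Int.cast_zero, hH₂, hH₁, hH₀] at h
  have hform : (a₂ : ZMod ℓ) * ((u : ZMod ℓ) * p₁) ^ 2 + (a₁ : ZMod ℓ) * ((u : ZMod ℓ) * p₁) * ((q : ZMod ℓ) * d₁) +
      (a₀ : ZMod ℓ) * ((q : ZMod ℓ) * d₁) ^ 2 = 0 := by
    have h' : ((u : ℤ) : ZMod ℓ) ^ n * ((a₂ : ZMod ℓ) * ((u : ZMod ℓ) * p₁) ^ 2 +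
        (a₁ : ZMod ℓ) * ((u : ZMod ℓ) * p₁) * ((q : ZMod ℓ) * d₁) + (a₀ : ZMod ℓ) * ((q : ZMod ℓ) * d₁) ^ 2) = 0 := by
      linear_combination h
    exact (mul_eq_zero.mp h').resolve_left (pow_ne_zero _ hu)
  obtain ⟨hp, hd⟩ := haniso _ _ hform
  exact ⟨(ZMod.intCast_zmod_eq_zero_iff_dvd _ ℓ).mp ((mul_eq_zero.mp hp).resolve_left hu),
    (ZMod.intCast_zmod_eq_zero_iff_dvd _ ℓ).mp ((mul_eq_zero.mp hd).resolve_left hq)⟩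

/-- **THE `v_ℓ`-DESCENT** (pure `ℤ`-arithmetic): `num r ≠ 0 ≠ q` in `𝔽_ℓ`, `ℓ ∣ den r`, tangent form anisotropic mod `ℓ`
⟹ `p²·hf c₂ (n+2) + p·q·den r·hf c₁ (n+1) + q²·(den r)²·hf c₀ n ≠ 0` — else `ℓ^m ∣ p` and `ℓ^m ∣ den r` for EVERY `m`. -/
theorem tangent_descent {ℓ : ℕ} [Fact ℓ.Prime] (c : ℕ → ℤ[X]) (n : ℕ)
    (haniso : ∀ a b : ZMod ℓ, (((c 2).coeff (n + 2) : ℤ) : ZMod ℓ) * a ^ 2 + (((c 1).coeff (n + 1) : ℤ) : ZMod ℓ) * a * b +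
      (((c 0).coeff n : ℤ) : ZMod ℓ) * b ^ 2 = 0 → a = 0 ∧ b = 0)
    {r : ℚ} (hu : ((r.num : ℤ) : ZMod ℓ) ≠ 0) (hd : (ℓ : ℤ) ∣ (r.den : ℤ)) {q : ℤ} (hq : ((q : ℤ) : ZMod ℓ) ≠ 0) (p : ℤ) :
    p ^ 2 * hf (c 2) (n + 2) r + p * q * (r.den : ℤ) * hf (c 1) (n + 1) r + q ^ 2 * (r.den : ℤ) ^ 2 * hf (c 0) n r ≠ 0 := by
  intro hE
  have hH₂ := cast_hf_of_dvd (ℓ := ℓ) (c 2) (n + 2) hd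
  have hH₁ := cast_hf_of_dvd (ℓ := ℓ) (c 1) (n + 1) hd
  have hH₀ := cast_hf_of_dvd (ℓ := ℓ) (c 0) n hd
  have hℓ0 : (ℓ : ℤ) ≠ 0 := Nat.cast_ne_zero.mpr (Fact.out : ℓ.Prime).ne_zero
  -- the descent: `ℓ^m ∣ p` and `ℓ^m ∣ den r` for every `m`
  have key : ∀ m : ℕ, (ℓ : ℤ) ^ m ∣ p ∧ (ℓ : ℤ) ^ m ∣ (r.den : ℤ) := by
    intro m
    induction m with
    | zero => simp
    | succ m ih =>
      obtain ⟨⟨p₁, hp₁⟩, ⟨d₁, hd₁⟩⟩ := ih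
      have hE₁ : p₁ ^ 2 * hf (c 2) (n + 2) r + p₁ * q * d₁ * hf (c 1) (n + 1) r +
          q ^ 2 * d₁ ^ 2 * hf (c 0) n r = 0 := by
        have e : ((ℓ : ℤ) ^ m) ^ 2 * (p₁ ^ 2 * hf (c 2) (n + 2) r + p₁ * q * d₁ * hf (c 1) (n + 1) r +
            q ^ 2 * d₁ ^ 2 * hf (c 0) n r) =
            p ^ 2 * hf (c 2) (n + 2) r + p * q * (r.den : ℤ) * hf (c 1) (n + 1) r +
              q ^ 2 * (r.den : ℤ) ^ 2 * hf (c 0) n r := by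
          rw [hp₁, hd₁]; ring
        have h' : ((ℓ : ℤ) ^ m) ^ 2 * (p₁ ^ 2 * hf (c 2) (n + 2) r + p₁ * q * d₁ * hf (c 1) (n + 1) r +
            q ^ 2 * d₁ ^ 2 * hf (c 0) n r) = 0 := by rw [e]; exact hE
        exact (mul_eq_zero.mp h').resolve_left (pow_ne_zero _ (pow_ne_zero _ hℓ0))
      obtain ⟨hp', hd'⟩ := descent_step _ _ _ haniso hu hq hH₂ hH₁ hH₀ hE₁
      exact ⟨by rw [hp₁, pow_succ]; exact mul_dvd_mul_left _ hp', by rw [hd₁, pow_succ]; exact mul_dvd_mul_left _ hd'⟩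
  -- a positive integer is not divisible by every power of `ℓ`
  have hlt : r.den < ℓ ^ r.den := Nat.lt_pow_self (Fact.out : ℓ.Prime).one_lt
  have hdvd : ℓ ^ r.den ∣ r.den := by
    have := (key r.den).2
    rw [← Nat.cast_pow] at this
    exact Int.natCast_dvd_natCast.mp this
  exact r.den_nz (Nat.eq_zero_of_dvd_of_lt hdvd hlt)

/-- **THE W4-SHAPE ENGINE, LEVEL-BLIND CORE.**  `P = c₂(Y)·x² + c₁(Y)·x + c₀(Y)` with `deg c₂ ≤ n+2`, `deg c₁ ≤ n+1`,
`deg c₀ ≤ n`, a prime `ℓ`, NO affine `𝔽_ℓ`-point, and the TANGENT FORM at `(0, ∞)`,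
`[Y^{n+2}]c₂·X² + [Y^{n+1}]c₁·XT + [Y^n]c₀·T²`, ANISOTROPIC mod `ℓ`: then `P` has NO RATIONAL POINT WITH `ℓ`-INTEGRAL
ABSCISSA.  (The degree conditions `h1`, `h0` are load-bearing: they put the factors `d`, `d²` on `H₁`, `H₀`.) -/
theorem ratPoint_free_of_tangent (c : ℕ → ℤ[X]) (n : ℕ) (h2 : (c 2).natDegree ≤ n + 2) (h1 : (c 1).natDegree ≤ n + 1)
    (h0 : (c 0).natDegree ≤ n) {ℓ : ℕ} [Fact ℓ.Prime]
    (haff : ∀ x y : ZMod ℓ, ∑ j ∈ Finset.range 3, x ^ j * aeval y (c j) ≠ 0)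
    (haniso : ∀ a b : ZMod ℓ, (((c 2).coeff (n + 2) : ℤ) : ZMod ℓ) * a ^ 2 + (((c 1).coeff (n + 1) : ℤ) : ZMod ℓ) * a * b +
      (((c 0).coeff n : ℤ) : ZMod ℓ) * b ^ 2 = 0 → a = 0 ∧ b = 0)
    (x r : ℚ) (hx : ¬ ℓ ∣ x.den) : bev (xPolyP 2 c) x r ≠ 0 := by
  intro hP
  have hn : ∀ j, j ≤ 2 → (c j).natDegree ≤ n + 2 := by
    intro j hj
    interval_cases j
    · exact h0.trans (by omega)
    · exact h1.trans (by omega)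
    · exact h2
  by_cases hden : ℓ ∣ r.den
  swap
  · obtain ⟨a, y, hay⟩ := affine_point_of_ratPoint 2 c hn hP hx hden
    exact haff a y hay
  have hdZ : (ℓ : ℤ) ∣ (r.den : ℤ) := Int.natCast_dvd_natCast.mpr hden
  have hu : ((r.num : ℤ) : ZMod ℓ) ≠ 0 := num_ne_zero_zmod_of_dvd_den r hden
  have hq : (((x.den : ℤ) : ℤ) : ZMod ℓ) ≠ 0 := by
    rw [Int.cast_natCast]; exact natCast_ne_zero_zmod_of_not_dvd hx
  have hE := pointSum_eq_zero 2 c hn hP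
  refine tangent_descent c n haniso hu hdZ hq x.num ?_
  rw [← hE, Finset.sum_range_succ, Finset.sum_range_succ, Finset.sum_range_one, hf_succ (c 1) h1,
    hf_succ (c 0) (h0.trans (Nat.le_succ n)), hf_succ (c 0) h0]
  norm_num
  ring

/-- **… hence NO LEVEL POINT** (DERIVED from the level-blind core: `ℓ ≠ 2`, `den s_N` a power of `2`). -/
theorem no_level_of_tangent (c : ℕ → ℤ[X]) (n : ℕ) (h2 : (c 2).natDegree ≤ n + 2) (h1 : (c 1).natDegree ≤ n + 1)
    (h0 : (c 0).natDegree ≤ n) {ℓ : ℕ} [Fact ℓ.Prime] (hℓ : ℓ ≠ 2)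
    (haff : ∀ x y : ZMod ℓ, ∑ j ∈ Finset.range 3, x ^ j * aeval y (c j) ≠ 0)
    (haniso : ∀ a b : ZMod ℓ, (((c 2).coeff (n + 2) : ℤ) : ZMod ℓ) * a ^ 2 + (((c 1).coeff (n + 1) : ℤ) : ZMod ℓ) * a * b +
      (((c 0).coeff n : ℤ) : ZMod ℓ) * b ^ 2 = 0 → a = 0 ∧ b = 0)
    (N : ℕ) (r : ℚ) : bev (xPolyP 2 c) (partialSum 2 N) r ≠ 0 := by
  rw [partialSum_two_eq_ratCast]
  exact ratPoint_free_of_tangent c n h2 h1 h0 haff haniso _ r (not_dvd_den_level (Fact.out : ℓ.Prime) hℓ N)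

/-- [class] definition (census convention): **TANGENT EMPTINESS `TangentEmptyAt ℓ P`** (the W4 shape) — a presentation
`P = c₂x² + c₁x + c₀` with `deg c₂ ≤ n+2`, `deg c₁ ≤ n+1`, `deg c₀ ≤ n`, a prime `ℓ ≠ 2`, NO affine `𝔽_ℓ`-point, and the
tangent form `[Y^{n+2}]c₂·X² + [Y^{n+1}]c₁·XT + [Y^n]c₀·T²` ANISOTROPIC mod `ℓ`. -/
def TangentEmptyAt (ℓ : ℕ) (P : ℤ[X][X]) : Prop :=
  ∃ (c : ℕ → ℤ[X]) (n : ℕ), P = xPolyP 2 c ∧ (c 2).natDegree ≤ n + 2 ∧ (c 1).natDegree ≤ n + 1 ∧ (c 0).natDegree ≤ n ∧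
    ℓ.Prime ∧ ℓ ≠ 2 ∧ (∀ x y : ZMod ℓ, ∑ j ∈ Finset.range 3, x ^ j * aeval y (c j) ≠ 0) ∧
    (∀ a b : ZMod ℓ, (((c 2).coeff (n + 2) : ℤ) : ZMod ℓ) * a ^ 2 + (((c 1).coeff (n + 1) : ℤ) : ZMod ℓ) * a * b +
      (((c 0).coeff n : ℤ) : ZMod ℓ) * b ^ 2 = 0 → a = 0 ∧ b = 0)

/-- **LEVEL-BLIND CORE: a `TangentEmptyAt ℓ` pair has NO RATIONAL POINT WITH `ℓ`-INTEGRAL ABSCISSA.** -/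
theorem ratPoint_free_of_tangentEmptyAt {ℓ : ℕ} {P : ℤ[X][X]} (h : TangentEmptyAt ℓ P) (x r : ℚ) (hx : ¬ ℓ ∣ x.den) :
    bev P x r ≠ 0 := by
  obtain ⟨c, n, rfl, h2, h1, h0, hprime, -, haff, haniso⟩ := h
  haveI : Fact ℓ.Prime := ⟨hprime⟩
  exact ratPoint_free_of_tangent c n h2 h1 h0 haff haniso x r hx

/-- **… hence NO LEVEL POINT AT ALL** (derived). -/
theorem no_level_of_tangentEmptyAt {ℓ : ℕ} {P : ℤ[X][X]} (h : TangentEmptyAt ℓ P) (N : ℕ) (r : ℚ) :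
    bev P (partialSum 2 N) r ≠ 0 := by
  have ⟨_, _, _, _, _, _, hprime, hℓ, _⟩ := h
  rw [partialSum_two_eq_ratCast]
  exact ratPoint_free_of_tangentEmptyAt h _ r (not_dvd_den_level hprime hℓ N)

/-- `TangentEmptyAt ℓ P → LevelFinite P` (every level set EMPTY). -/
theorem levelFinite_of_tangentEmptyAt {ℓ : ℕ} {P : ℤ[X][X]} (h : TangentEmptyAt ℓ P) : LevelFinite P :=
  levelFinite_of_no_level (no_level_of_tangentEmptyAt h)

/-- `TangentEmptyAt ℓ P → BddLevelEmpty P`. -/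
theorem bddLevelEmpty_of_tangentEmptyAt {ℓ : ℕ} {P : ℤ[X][X]} (h : TangentEmptyAt ℓ P) : BddLevelEmpty P :=
  (bddLevelEmpty_iff_levelFinite P).mpr (levelFinite_of_tangentEmptyAt h)

/-- **`TangentEmptyAt ℓ P → ThinFibreAt m₀ P` at EVERY quality `m₀`**, hypothesis-free. -/
theorem thinFibreAt_of_tangentEmptyAt {ℓ : ℕ} {P : ℤ[X][X]} (h : TangentEmptyAt ℓ P) (m₀ : ℕ) : ThinFibreAt m₀ P :=
  thinFibreAt_of_levelFinite (levelFinite_of_tangentEmptyAt h) m₀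

/-! ### §4b REFUSALS: what KILLS `OddEmptyAt ℓ` / `TangentEmptyAt ℓ` -/

/-- a RATIONAL POINT WITH `ℓ`-INTEGRAL ABSCISSA kills `OddEmptyAt ℓ` (the standing-witness immunity, typed). -/
theorem not_oddEmptyAt_of_ratPoint {ℓ : ℕ} {P : ℤ[X][X]} (x y : ℚ) (hx : ¬ ℓ ∣ x.den) (h : bev P x y = 0) :
    ¬ OddEmptyAt ℓ P := fun hO => ratPoint_free_of_oddEmptyAt hO x y hx h

/-- a rational point with `ℓ`-integral abscissa kills `TangentEmptyAt ℓ`. -/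
theorem not_tangentEmptyAt_of_ratPoint {ℓ : ℕ} {P : ℤ[X][X]} (x y : ℚ) (hx : ¬ ℓ ∣ x.den) (h : bev P x y = 0) :
    ¬ TangentEmptyAt ℓ P := fun hT => ratPoint_free_of_tangentEmptyAt hT x y hx h

/-- in any presentation `P = xPolyP k c`, the affine sum at `x = 0` is `c₀(y)` and `c₀ = xCoeff P 0`. -/
theorem sum_at_zero_eq {P : ℤ[X][X]} {k : ℕ} {c : ℕ → ℤ[X]} (hP : P = xPolyP k c) {R : Type*} [CommRing R]
    [Algebra ℤ R] (y : R) : ∑ j ∈ Finset.range (k + 1), (0 : R) ^ j * aeval y (c j) = aeval y (xCoeff P 0) := by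
  have hc0 : xCoeff P 0 = c 0 := by rw [hP, xCoeff_xPolyP, if_pos (Nat.zero_le k)]
  rw [hc0, Finset.sum_eq_single 0 (fun j _ hj => by rw [zero_pow hj, zero_mul]) (fun h => absurd (by simp) h),
    pow_zero, one_mul]

/-- an AFFINE `𝔽_ℓ`-POINT `(0, y)` — a root of `c₀ = xCoeff P 0` mod `ℓ` — kills `OddEmptyAt ℓ`. -/
theorem not_oddEmptyAt_of_root_zero {ℓ : ℕ} {P : ℤ[X][X]} (y : ZMod ℓ) (h : aeval y (xCoeff P 0) = 0) :
    ¬ OddEmptyAt ℓ P := by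
  rintro ⟨k, c, n, hP, -, -, -, haff, -⟩
  exact haff 0 y (by rw [sum_at_zero_eq hP, h])

/-- an affine `𝔽_ℓ`-point `(0, y)` kills `TangentEmptyAt ℓ`. -/
theorem not_tangentEmptyAt_of_root_zero {ℓ : ℕ} {P : ℤ[X][X]} (y : ZMod ℓ) (h : aeval y (xCoeff P 0) = 0) :
    ¬ TangentEmptyAt ℓ P := by
  rintro ⟨c, n, hP, -, -, -, -, -, haff, -⟩
  exact haff 0 y (by rw [sum_at_zero_eq hP, h])

/-- `deg c₀ < deg c_i` for some `i` ⟹ the `Y`-top form of EVERY presentation has the root `x = 0` ⟹ `¬ OddEmptyAt ℓ`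
(the point `(0, ∞)` does not go away by choosing `ℓ`; this is why the W4 shape needs the tangent-form engine). -/
theorem not_oddEmptyAt_of_natDegree_lt {ℓ : ℕ} {P : ℤ[X][X]} (i : ℕ)
    (h : (xCoeff P 0).natDegree < (xCoeff P i).natDegree) : ¬ OddEmptyAt ℓ P := by
  rintro ⟨k, c, n, hP, hn, -, -, -, htop⟩
  have hik : i ≤ k := by
    by_contra hik
    have : xCoeff P i = 0 := by rw [hP, xCoeff_xPolyP, if_neg hik]
    rw [this, natDegree_zero] at h
    exact Nat.not_lt_zero _ h
  have hci : xCoeff P i = c i := by rw [hP, xCoeff_xPolyP, if_pos hik]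
  have hc0 : xCoeff P 0 = c 0 := by rw [hP, xCoeff_xPolyP, if_pos (Nat.zero_le k)]
  have hlt : (c 0).natDegree < n := by
    rw [hci, hc0] at h
    exact h.trans_le (hn i hik)
  refine htop 0 ?_
  rw [Finset.sum_eq_single 0 (fun j _ hj => by rw [zero_pow hj, zero_mul]) (fun h => absurd (by simp) h), pow_zero,
    one_mul, coeff_eq_zero_of_natDegree_lt hlt, Int.cast_zero]

/-- `ℓ = 2` is REFUSED by definition (the level abscissae have 2-power denominators). -/
theorem not_oddEmptyAt_two (P : ℤ[X][X]) : ¬ OddEmptyAt 2 P := fun ⟨_, _, _, _, _, _, h, _⟩ => h rfl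

/-- `(P : ℤ[X][X]) : ¬ TangentEmptyAt 2 P`. -/
theorem not_tangentEmptyAt_two (P : ℤ[X][X]) : ¬ TangentEmptyAt 2 P := fun ⟨_, _, _, _, _, _, _, h, _⟩ => h rfl

end Summit.Schanuel.Schanuel.Theorems.RootDecomp1KOddEmpty

end
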